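import Mathlib

/-!
# Gaussian extension of an injective real-closed evaluation (solo-blind, s24; hodge.md §8.15.2 Corollary B)

The algebraic core of Corollary B of §8.15.2: if a commutative `ℚ`-algebra `P` is *formally real for two
squares* (`x^2 + y^2 = 0 → x = 0 ∧ y = 0`, e.g. a polynomial ring over `ℚ`, which is what the motivic
period algebra of a mixed Tate category is) and `ev : P →ₐ[ℚ] ℂ` is injective (the summit, in the form
"evaluation of motivic periods is injective over `ℚ`"), then the `ℚ(i)`-linear extension of `ev` is
injective as well: `ev x + i·ev y = 0` forces `x = y = 0`.  The proof is the identity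
`(ev x + i ev y)(ev x − i ev y) = ev (x² + y²)`.  We also record that `MvPolynomial σ ℚ` is formally real
for two squares (evaluate at every rational point and use `MvPolynomial.funext`), so the hypothesis is met
by any polynomial `ℚ`-algebra — in the application, by `P^𝔪 ⊗ ℚ ≅ ℚ[free generators]`.
-/

namespace Summit.KontsevichZagierPeriods.KontsevichZagierPeriods.Theorems.SoloBlindGaussianExtension

/-- If `P` is formally real for two squares and `ev : P →ₐ[ℚ] ℂ` is injective, then
`ev x + I * ev y = 0` implies `x = 0 ∧ y = 0`: the Gaussian (`ℚ(i)`-linear) extension of `ev` is injective. -/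
theorem gaussian_extension_injective {P : Type*} [CommRing P] [Algebra ℚ P]
    (hreal : ∀ x y : P, x ^ 2 + y ^ 2 = 0 → x = 0 ∧ y = 0)
    (ev : P →ₐ[ℚ] ℂ) (hev : Function.Injective ev) (x y : P)
    (h : ev x + Complex.I * ev y = 0) : x = 0 ∧ y = 0 := by
  apply hreal
  apply hev
  rw [map_zero, map_add, map_pow, map_pow]
  have hprod : (ev x + Complex.I * ev y) * (ev x - Complex.I * ev y) = 0 := by
    rw [h, zero_mul]
  have hI : Complex.I ^ 2 = -1 := Complex.I_sq
  linear_combination hprod + (ev y) ^ 2 * hI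

/-- A relation `∑ (aⱼ + i bⱼ) · ev pⱼ = 0` with Gaussian-rational coefficients, packaged as
`ev x + I * ev y = 0` with `x = ∑ aⱼ pⱼ`, `y = ∑ bⱼ pⱼ`, holds already in `P`: both `x` and `y` vanish.
Stated for finite families. -/
theorem gaussian_relation_lifts {P : Type*} [CommRing P] [Algebra ℚ P]
    (hreal : ∀ x y : P, x ^ 2 + y ^ 2 = 0 → x = 0 ∧ y = 0)
    (ev : P →ₐ[ℚ] ℂ) (hev : Function.Injective ev) {ι : Type*} (s : Finset ι)
    (a b : ι → ℚ) (p : ι → P)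
    (h : ∑ j ∈ s, ((a j : ℂ) + Complex.I * (b j : ℂ)) * ev (p j) = 0) :
    (∑ j ∈ s, a j • p j) = 0 ∧ (∑ j ∈ s, b j • p j) = 0 := by
  apply gaussian_extension_injective hreal ev hev
  rw [map_sum, map_sum, Finset.mul_sum, ← Finset.sum_add_distrib, ← h]
  refine Finset.sum_congr rfl fun j _ => ?_
  rw [map_smul, map_smul, Algebra.smul_def, Algebra.smul_def, eq_ratCast, eq_ratCast]
  ring

/-- `MvPolynomial σ ℚ` is formally real for two squares: `p ^ 2 + q ^ 2 = 0 → p = 0 ∧ q = 0`. -/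
theorem mvPolynomial_two_squares {σ : Type*} (p q : MvPolynomial σ ℚ)
    (h : p ^ 2 + q ^ 2 = 0) : p = 0 ∧ q = 0 := by
  have key : ∀ a : σ → ℚ, MvPolynomial.eval a p = 0 ∧ MvPolynomial.eval a q = 0 := by
    intro a
    have h' := congrArg (MvPolynomial.eval a) h
    simp only [map_add, map_pow, map_zero] at h'
    have hp := sq_nonneg (MvPolynomial.eval a p)
    have hq := sq_nonneg (MvPolynomial.eval a q)
    constructor
    · exact pow_eq_zero_iff (n := 2) (by norm_num) |>.mp (by linarith)
    · exact pow_eq_zero_iff (n := 2) (by norm_num) |>.mp (by linarith)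
  constructor
  · exact MvPolynomial.funext fun a => by rw [(key a).1, map_zero]
  · exact MvPolynomial.funext fun a => by rw [(key a).2, map_zero]

/-- Corollary B, algebraic form: for an injective `ℚ`-algebra evaluation of a polynomial `ℚ`-algebra into `ℂ`,
every `ℚ(i)`-linear relation among values is already a pair of `ℚ`-linear relations in the algebra. -/
theorem corollaryB_mvPolynomial {σ : Type*} (ev : MvPolynomial σ ℚ →ₐ[ℚ] ℂ)
    (hev : Function.Injective ev) (x y : MvPolynomial σ ℚ)
    (h : ev x + Complex.I * ev y = 0) : x = 0 ∧ y = 0 :=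
  gaussian_extension_injective mvPolynomial_two_squares ev hev x y h

end Summit.KontsevichZagierPeriods.KontsevichZagierPeriods.Theorems.SoloBlindGaussianExtension
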